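import Summits.ResolutionOfSingularities.ResolutionOfSingularities.Theorems.FrobeniusClosingPatchingRelPerfectDepthMultiHostFormatSnc
import Summits.ResolutionOfSingularities.ResolutionOfSingularities.Theorems.FrobeniusClosingPatchingRelPerfectDepthMultiHostCyl
import Literature.AlgebraicGeometry.Limits.IdealSheafExtension
import HarnessLib

/-!
# Crux `PatchingRelPerfect` (stmt-ResolutionOfSingularities-16161), chain W5.2 — F7(β) d = 2 (β-AX), X2c = T2c (hypothesis-shaped):
# a cylinder state whose host traces are monomials in ONE family on the carrier is FORMAT-SNC END on its cylinder region

[OURS · L1 W5.2 · F7(β) (β-AX) X2c · res-L1-w52-plan-1 ASSEMBLY SPEC v4.1 §6 A1 «T2c `CylState.isFormatSncOn_of_cjsEnd`: CJS-end data on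
the carrier in N4 shape (one snc family on E_n′ presenting every trace tr_i = monomialIdeal q_i and containing the boundary) ⊢
`S_n.IsFormatSncOn 𝓗_n V_n` … NO cosupp clause», RULING G11-17 (2)(ii), G11-18 «U := cyl.V», NOTE G11-22 «CYL-SNC (state it once, in
pv-034΄s `…CylCentre` file) … (T2c) … format components on V := carrier :: cylinders».]  Replaces the role of NO printed item; NOT a
statement of the manuscript under review; fact-free.  AI-written; AI review is weaker than expert review.  No definitions.

## Contents (namespace `…Theorems.DepthMultiHost`)
* `comap_map_ι` — GLOBALISATION of an ideal sheaf on an open: `(J.map V.ι)|_V = J` (Mathlib's push-forward `Scheme.IdealSheafData.map`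
  + the tree's `Literature.AlgebraicGeometry.Limits.comap_map_of_isOpenImmersion`; `V.ι` is quasi-compact on a locally Noetherian `X`).
  No reducedness / closure argument is needed.
* `CylState.cylinder cyl D := (D.comap cyl.q).map cyl.V.ι` — the GLOBAL CYLINDER over a carrier ideal `D` (an ideal sheaf of `X`
  restricting on `V` to the cylinder `q^* D`): `comap_cylinder_ι`, `comap_member_V` (a member `T ≠ carrier` restricts on `V` to the
  cylinder over its trace `bd T`).
* **`CylState.isFormatSncOn_of_traces`** (T2c, hypothesis-shaped): if every host trace is a monomial `tr i = Π_{D ∈ 𝓖} D^{c i D}` in ONE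
  list `𝓖` of carrier ideals containing the member traces `bd T` (`T ∈ S.𝓔`, `T ≠ carrier`), and SOME family `𝓕V` on `V` containing the
  cylinders `q^* D` (`D ∈ 𝓖`) and the carrier `j.ker|_V` has simple normal crossings (CYL-SNC — res-D-pv-034's `…DepthMultiHostCylCentre`,
  from `CylState.param`; taken here as the hypotheses `hcyl`/`h𝓖`/`hcar`, any member order), then `S.IsFormatSncOn cyl.V 𝓒 𝓗` with
  components `𝓒 := 𝓖.map cylinder` and host lists `𝓖.map (D ↦ (cylinder D, c i D)) ++ S.𝓔.map (T ↦ (T, 0))`.  Proof: `host_eq` + «comap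
  of a monomial = monomial of comaps»; the member part of the format family restricts INTO the CYL-SNC family (`member_eq`), and snc
  depends on membership only.  `isFormatSncOn_of_traces_of_hasSNC_append` — the order «cylinders ++ [carrier]» of NOTE G11-22.
* `CylState.exists_isFormatSncOn_of_traces` — the `∃ 𝓗` form over the `∃ c` presentation shape of res-D-pv-054's
  `MultiHostCJS.end_components` / `transport_of_cjsB` (per-host exponent functions).
* §3 `CylState.globalise` — MEMBER-AWARE globalisation (a trace `bd T` goes back to a member `T`, anything else to its global
  cylinder; `comap_globalise_ι`), `isFormatSncOn_globalise_of_traces` (T2c with components `𝓖.map globalise`), and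
  `globalise_mem_of_comap_eq` (no component is a distinct copy ON `V` of a member) — the form the POINTWISE snc reading on `X` wants.

## References
* E. Bierstone, D. Grigoriev, P. Milman, J. Włodarczyk, *Effective Hironaka resolution and its complexity*, Asian J. Math. 15 (2011),
  Def. 3.1.1, Def. 3.1.3. [BierstoneGrigorievMilmanWlodarczyk2011]
* J. Kollár, *Lectures on Resolution of Singularities* (2007), (3.111) Steps 1–3. [Kollar2007]
* U. Görtz, T. Wedhorn, *Algebraic Geometry I* (2nd ed., 2020), Prop. 13.91, (10.7) (scheme-theoretic image of a quasi-compact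
  immersion). [GortzWedhorn2020]
-/

-- `Summit.<Summit>.<Sub>.Theorems` with `Sub = Summit` (single-conjunct summit, D-0017)
set_option linter.dupNamespace false

noncomputable section

open CategoryTheory AlgebraicGeometry TopologicalSpace
open Literature.AlgebraicGeometry.Resolution
open Scheme.IdealSheafData

namespace Summit.ResolutionOfSingularities.ResolutionOfSingularities.Theorems.DepthMultiHost

universe u

variable {X : Scheme.{u}}

/-! ## §1 Globalising an ideal sheaf from an open -/

/-- **`(J.map V.ι)|_V = J`**: the push-forward of an ideal sheaf of the open `V` along `V.ι` (ideal of the scheme-theoretic image)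
restricts back to it (`V.ι` is a quasi-compact open immersion on a locally Noetherian `X`). [cite: GortzWedhorn2020, (10.7) and Prop. 10.30] -/
theorem comap_map_ι [IsLocallyNoetherian X] (V : X.Opens) (J : (V : Scheme.{u}).IdealSheafData) : (J.map V.ι).comap V.ι = J :=
  Literature.AlgebraicGeometry.Limits.comap_map_of_isOpenImmersion V.ι J

namespace CylState

variable [IsLocallyNoetherian X] {S : MultiHostState X} (cyl : CylState S)

/-- [OURS · L1 W5.2] **The global cylinder over a carrier ideal `D`**: the push-forward to `X` of the cylinder `q^* D ⊆ V`.
[cite: Kollar2007, (3.111) Step 1] -/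
def cylinder (D : cyl.Z.IdealSheafData) : X.IdealSheafData :=
  (D.comap cyl.q).map cyl.V.ι

/-- **On the cylinder region the global cylinder IS the cylinder**: `(cylinder D)|_V = q^* D`. [folklore] -/
@[simp] theorem comap_cylinder_ι (D : cyl.Z.IdealSheafData) : (cyl.cylinder D).comap cyl.V.ι = D.comap cyl.q :=
  comap_map_ι cyl.V (D.comap cyl.q)

omit [IsLocallyNoetherian X] in
/-- A member other than the carrier restricts on `V` to the cylinder over its trace (the cylinder identity `member_eq`). [folklore] -/
theorem comap_member_V {T : X.IdealSheafData} (hT : T ∈ S.𝓔) (hne : T ≠ cyl.j.ker) :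
    T.comap cyl.V.ι = (cyl.bd T).comap cyl.q :=
  cyl.member_eq T hT hne

/-! ## §2 T2c (hypothesis-shaped): monomial traces in one carrier family ⇒ format-snc END on `V` -/

/-- **T2c (res-L1-w52-plan-1 spec v4.1 §6 A1, G11-22), hypothesis-shaped.**  Let `cyl` be a cylinder state over `S`, `𝓖` a list of carrier
ideals containing the member traces `bd T` (`T ∈ S.𝓔`, `T ≠ carrier`), and `c i` exponent functions with `tr i = monomialIdeal (𝓖.map (D ↦
(D, c i D)))` for every host.  If the family «cylinders `q^* D` (`D ∈ 𝓖`), then the carrier `j.ker|_V`» has simple normal crossings on `V`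
(CYL-SNC, from `CylState.param`; hypothesis `hcyl`), then `S` is FORMAT-SNC END on `cyl.V` with components the global cylinders
`𝓖.map cylinder` and host lists `𝓖.map (D ↦ (cylinder D, c i D)) ++ S.𝓔.map (T ↦ (T, 0))`.  No cosupport clause, no host regularity.
[cite: BierstoneGrigorievMilmanWlodarczyk2011, Def. 3.1.1 and Def. 3.1.3] [cite: Kollar2007, (3.111) Steps 1–3] -/
theorem isFormatSncOn_of_traces (𝓖 : List cyl.Z.IdealSheafData) (c : Fin S.n → cyl.Z.IdealSheafData → ℕ)
    (htr : ∀ i, cyl.tr i = monomialIdeal (𝓖.map fun D => (D, c i D)))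
    (hbd : ∀ T ∈ S.𝓔, T ≠ cyl.j.ker → cyl.bd T ∈ 𝓖) {𝓕V : List (cyl.V : Scheme.{u}).IdealSheafData} (hcyl : HasSNC 𝓕V)
    (h𝓖 : ∀ D ∈ 𝓖, D.comap cyl.q ∈ 𝓕V) (hcar : cyl.j.ker.comap cyl.V.ι ∈ 𝓕V) :
    S.IsFormatSncOn cyl.V (𝓖.map cyl.cylinder)
      fun i => (𝓖.map fun D => (cyl.cylinder D, c i D)) ++ S.𝓔.map fun T => (T, 0) := by
  have h0 : ∀ L : List X.IdealSheafData, monomialIdeal (L.map fun T => (T, 0)) = ⊤ := by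
    intro L
    induction L with
    | nil => rw [List.map_nil, monomialIdeal_nil]
    | cons T L ih => rw [List.map_cons, monomialIdeal_cons, ih, pow_zero, Scheme.IdealSheafData.one_eq_top,
        Scheme.IdealSheafData.top_mul]
  refine ⟨fun i => ?_, ?_, fun i => ?_⟩
  · simp [boundaryOf, List.map_append, List.map_map, Function.comp_def]
  · -- the format family restricts into the CYL-SNC family
    refine DepthGraded.Trace.hasSNCWith_of_subset hcyl fun D hD => ?_
    rw [List.map_append, List.mem_append, List.map_map] at hD
    rcases hD with hD | hD
    · obtain ⟨G, hG, rfl⟩ := List.mem_map.mp hD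
      simp only [Function.comp_apply, comap_cylinder_ι]
      exact h𝓖 G hG
    · obtain ⟨T, hT, rfl⟩ := List.mem_map.mp hD
      by_cases hTc : T = cyl.j.ker
      · subst hTc
        exact hcar
      · rw [cyl.comap_member_V hT hTc]
        exact h𝓖 (cyl.bd T) (hbd T hT hTc)
  · -- the host factorisation: `host i|_V = q^*(tr i) = monomial of the cylinders`
    rw [cyl.host_eq i, htr i, monomialIdeal_append, h0, Scheme.IdealSheafData.mul_top, DepthTargets.comap_monomialIdeal_eq_map,
      DepthTargets.comap_monomialIdeal_eq_map, List.map_map, List.map_map]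
    congr 1
    refine List.map_congr_left fun D _ => ?_
    simp only [Function.comp_apply, comap_cylinder_ι]

/-- **T2c, `∃`-form over per-host exponent functions** (the presentation shape of res-D-pv-054's `MultiHostCJS.end_components` /
`transport_of_cjsB`: `∀ i, ∃ c, tr i = monomialIdeal (𝓖.map (D ↦ (D, c D)))`): SOME components and host lists make `S` format-snc END
on `cyl.V`. [cite: BierstoneGrigorievMilmanWlodarczyk2011, Def. 3.1.3] [cite: Kollar2007, (3.111) Steps 1–3] -/
theorem exists_isFormatSncOn_of_traces (𝓖 : List cyl.Z.IdealSheafData)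
    (htr : ∀ i, ∃ c : cyl.Z.IdealSheafData → ℕ, cyl.tr i = monomialIdeal (𝓖.map fun D => (D, c D)))
    (hbd : ∀ T ∈ S.𝓔, T ≠ cyl.j.ker → cyl.bd T ∈ 𝓖) {𝓕V : List (cyl.V : Scheme.{u}).IdealSheafData} (hcyl : HasSNC 𝓕V)
    (h𝓖 : ∀ D ∈ 𝓖, D.comap cyl.q ∈ 𝓕V) (hcar : cyl.j.ker.comap cyl.V.ι ∈ 𝓕V) :
    ∃ 𝓗 : Fin S.n → List (X.IdealSheafData × ℕ), S.IsFormatSncOn cyl.V (𝓖.map cyl.cylinder) 𝓗 := by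
  choose c hc using htr
  exact ⟨_, cyl.isFormatSncOn_of_traces 𝓖 c hc hbd hcyl h𝓖 hcar⟩

/-- **T2c with the CYL-SNC family in the order «cylinders, then the carrier»** (the shape res-L1-w52-plan-1 NOTE G11-22 names).
[cite: BierstoneGrigorievMilmanWlodarczyk2011, Def. 3.1.3] -/
theorem isFormatSncOn_of_traces_of_hasSNC_append (𝓖 : List cyl.Z.IdealSheafData) (c : Fin S.n → cyl.Z.IdealSheafData → ℕ)
    (htr : ∀ i, cyl.tr i = monomialIdeal (𝓖.map fun D => (D, c i D)))
    (hbd : ∀ T ∈ S.𝓔, T ≠ cyl.j.ker → cyl.bd T ∈ 𝓖)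
    (hcyl : HasSNC ((𝓖.map fun D => D.comap cyl.q) ++ [cyl.j.ker.comap cyl.V.ι])) :
    S.IsFormatSncOn cyl.V (𝓖.map cyl.cylinder)
      fun i => (𝓖.map fun D => (cyl.cylinder D, c i D)) ++ S.𝓔.map fun T => (T, 0) :=
  cyl.isFormatSncOn_of_traces 𝓖 c htr hbd hcyl (fun D hD => List.mem_append_left _ (List.mem_map.mpr ⟨D, hD, rfl⟩))
    (List.mem_append_right _ (List.mem_singleton.mpr rfl))

end CylState

/-! ## §3 Member-aware globalisation (no member is shadowed on `V` by a distinct component)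

The plain global cylinder `cylinder (bd T)` over the trace of a member `T` restricts on `V` to `T|_V` but is in general a DIFFERENT
ideal sheaf of `X`; a family containing both would have two distinct members with equal stalks at the points of `V ∩ Supp T`, which the
POINTWISE reading of simple normal crossings on `X` (`DepthSNC.SNCWithAt`, used by T3΄s END and by the openness lemma of res-D-pv-046)
forbids.  `globalise` therefore sends a trace `bd T` back to (some such) member `T` itself and every other carrier ideal to its global
cylinder. -/

namespace CylState

variable [IsLocallyNoetherian X] {S : MultiHostState X} (cyl : CylState S)

/-- [OURS · L1 W5.2] **Member-aware globalisation** of a carrier ideal `D`: a member `T ≠ carrier` of `S.𝓔` with trace `bd T = D` if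
there is one, else the global cylinder over `D`.  Either way `(globalise D)|_V = q^* D`. [cite: Kollar2007, (3.111) Step 1] -/
def globalise (D : cyl.Z.IdealSheafData) : X.IdealSheafData := by
  classical
  exact if h : ∃ T, T ∈ S.𝓔 ∧ T ≠ cyl.j.ker ∧ cyl.bd T = D then h.choose else cyl.cylinder D

omit [IsLocallyNoetherian X] in
/-- If `D` is the trace of a member, `globalise D` is a member `T ≠ carrier` with `bd T = D`. [folklore] -/
theorem globalise_spec_of_exists {D : cyl.Z.IdealSheafData} (h : ∃ T, T ∈ S.𝓔 ∧ T ≠ cyl.j.ker ∧ cyl.bd T = D) :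
    cyl.globalise D ∈ S.𝓔 ∧ cyl.globalise D ≠ cyl.j.ker ∧ cyl.bd (cyl.globalise D) = D := by
  classical
  have hdef : cyl.globalise D = h.choose := by
    unfold globalise
    rw [dif_pos h]
  rw [hdef]
  exact h.choose_spec

omit [IsLocallyNoetherian X] in
/-- Otherwise `globalise D` is the global cylinder. [folklore] -/
theorem globalise_of_not_exists {D : cyl.Z.IdealSheafData} (h : ¬ ∃ T, T ∈ S.𝓔 ∧ T ≠ cyl.j.ker ∧ cyl.bd T = D) :
    cyl.globalise D = cyl.cylinder D := by
  classical
  unfold globalise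
  rw [dif_neg h]

/-- **`(globalise D)|_V = q^* D`** in both cases. [folklore] -/
@[simp] theorem comap_globalise_ι (D : cyl.Z.IdealSheafData) : (cyl.globalise D).comap cyl.V.ι = D.comap cyl.q := by
  by_cases h : ∃ T, T ∈ S.𝓔 ∧ T ≠ cyl.j.ker ∧ cyl.bd T = D
  · obtain ⟨hT, hne, hbd⟩ := cyl.globalise_spec_of_exists h
    rw [cyl.comap_member_V hT hne, hbd]
  · rw [cyl.globalise_of_not_exists h, comap_cylinder_ι]

omit [IsLocallyNoetherian X] in
/-- `globalise D` is a member of `S.𝓔` or the global cylinder over `D`. [folklore] -/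
theorem globalise_mem_or_eq (D : cyl.Z.IdealSheafData) : cyl.globalise D ∈ S.𝓔 ∨ cyl.globalise D = cyl.cylinder D := by
  by_cases h : ∃ T, T ∈ S.𝓔 ∧ T ≠ cyl.j.ker ∧ cyl.bd T = D
  · exact Or.inl (cyl.globalise_spec_of_exists h).1
  · exact Or.inr (cyl.globalise_of_not_exists h)

/-- **T2c with member-aware components** (hypothesis-shaped as `isFormatSncOn_of_traces`): components `𝓖.map globalise`, host lists
`𝓖.map (D ↦ (globalise D, c i D)) ++ S.𝓔.map (T ↦ (T, 0))`. [cite: BierstoneGrigorievMilmanWlodarczyk2011, Def. 3.1.1 and Def. 3.1.3]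
[cite: Kollar2007, (3.111) Steps 1–3] -/
theorem isFormatSncOn_globalise_of_traces (𝓖 : List cyl.Z.IdealSheafData) (c : Fin S.n → cyl.Z.IdealSheafData → ℕ)
    (htr : ∀ i, cyl.tr i = monomialIdeal (𝓖.map fun D => (D, c i D)))
    (hbd : ∀ T ∈ S.𝓔, T ≠ cyl.j.ker → cyl.bd T ∈ 𝓖) {𝓕V : List (cyl.V : Scheme.{u}).IdealSheafData} (hcyl : HasSNC 𝓕V)
    (h𝓖 : ∀ D ∈ 𝓖, D.comap cyl.q ∈ 𝓕V) (hcar : cyl.j.ker.comap cyl.V.ι ∈ 𝓕V) :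
    S.IsFormatSncOn cyl.V (𝓖.map cyl.globalise)
      fun i => (𝓖.map fun D => (cyl.globalise D, c i D)) ++ S.𝓔.map fun T => (T, 0) := by
  have h0 : ∀ L : List X.IdealSheafData, monomialIdeal (L.map fun T => (T, 0)) = ⊤ := by
    intro L
    induction L with
    | nil => rw [List.map_nil, monomialIdeal_nil]
    | cons T L ih => rw [List.map_cons, monomialIdeal_cons, ih, pow_zero, Scheme.IdealSheafData.one_eq_top,
        Scheme.IdealSheafData.top_mul]
  refine ⟨fun i => ?_, ?_, fun i => ?_⟩
  · simp [boundaryOf, List.map_append, List.map_map, Function.comp_def]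
  · refine DepthGraded.Trace.hasSNCWith_of_subset hcyl fun D hD => ?_
    rw [List.map_append, List.mem_append, List.map_map] at hD
    rcases hD with hD | hD
    · obtain ⟨G, hG, rfl⟩ := List.mem_map.mp hD
      simp only [Function.comp_apply, comap_globalise_ι]
      exact h𝓖 G hG
    · obtain ⟨T, hT, rfl⟩ := List.mem_map.mp hD
      by_cases hTc : T = cyl.j.ker
      · subst hTc
        exact hcar
      · rw [cyl.comap_member_V hT hTc]
        exact h𝓖 (cyl.bd T) (hbd T hT hTc)
  · rw [cyl.host_eq i, htr i, monomialIdeal_append, h0, Scheme.IdealSheafData.mul_top, DepthTargets.comap_monomialIdeal_eq_map,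
      DepthTargets.comap_monomialIdeal_eq_map, List.map_map, List.map_map]
    congr 1
    refine List.map_congr_left fun D _ => ?_
    simp only [Function.comp_apply, comap_globalise_ι]

/-- **No member is shadowed**: a component `globalise D` (`D ∈ 𝓖`) that agrees ON `V` with a member `T ∈ S.𝓔` other than the carrier
IS a member of `S.𝓔` (so the family `𝓖.map globalise ++ S.𝓔` has no two DISTINCT members with the same restriction to `V` unless both
restrict like two distinct members of `S.𝓔`).  Uses the retraction: `q^*` is injective on carrier ideals (`jV ≫ q = 𝟙`). [folklore] -/
theorem globalise_mem_of_comap_eq {D : cyl.Z.IdealSheafData} {T : X.IdealSheafData} (hT : T ∈ S.𝓔) (hne : T ≠ cyl.j.ker)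
    (h : (cyl.globalise D).comap cyl.V.ι = T.comap cyl.V.ι) : cyl.globalise D ∈ S.𝓔 := by
  have hD : cyl.bd T = D := by
    have h1 := congrArg (fun I => I.comap cyl.jV) h
    simp only [comap_globalise_ι, cyl.comap_member_V hT hne, ← Scheme.IdealSheafData.comap_comp, cyl.retract,
      Scheme.IdealSheafData.comap_id] at h1
    exact h1.symm
  exact (cyl.globalise_spec_of_exists ⟨T, hT, hne, hD⟩).1

end CylState

end Summit.ResolutionOfSingularities.ResolutionOfSingularities.Theorems.DepthMultiHost

end
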